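import Summits.BirchSwinnertonDyer.Rank1Residual.GaloisImage.KolyvaginPrimeSmallImage
import Summits.BirchSwinnertonDyer.Rank1Residual.X4.KuriharaClasswide
import Literature.NumberTheory.EllipticCurves.VariableChangePointsMap
import Literature.NumberTheory.EllipticCurves.LFunctionPrimeCoeff
import HarnessLib

/-!
# `E[p] ↪ Ẽ(𝔽_ℓ)` ADDITIVELY on the integral model, and the typed Kurihara inputs at a prime of
# irreducible, non-surjective image: `¬ KuriharaUnitPrimeAt`, `KuriharaUnitAt ⇒ level 1`
# (cell `b2b-bsdres`, unit `b2b-bsdres-additive-p3`, gen 5; sequel of `KolyvaginPrimeSmallImage`)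

HONEST FRAMING (run/shared/lean/b2b/bsd-rank1-residual/, verbatim in every file): the goal of the
cell is to DELETE the COMBINATION-SHAPED residual classes of the Birch–Swinnerton-Dyer formula for
ALL analytic-rank `≤ 1` elliptic curves over `ℚ` — "full BSD formula for every rank `≤ 1` curve in
class `C`" assembled STRICTLY from published theorems — so that the rank-`≤ 1` remainder becomes
exactly the CONSTRUCTION-SHAPED classes, which are TYPED (missing-input `Prop`s), NOT attempted.
This is not "finishing BSD". THEOREMS ONLY (no definition, no named fact; nothing booked; labels
unchanged). A NO-GO about the cell's OWN typed inputs (`X4.KuriharaUnitAt`, `X4.KuriharaUnitPrimeAt`,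
this unit's gen-0 files), not a class theorem.

## What this file proves

`KolyvaginPrimeSmallImage.lean` (p216591): at a prime `p` with `E[p]` irreducible and `ρ̄_{E,p}` not
onto, every Kolyvagin prime `ℓ` (`ℓ ≡ 1`, `a_ℓ ≡ 2 (mod p)`) has a TRIVIAL Frobenius on `E[p]`, and
the point-count shadow `p² ∣ #Ẽ(𝔽_ℓ)`. Here the group-theoretic statement behind the shadow is made
literal ON THE INTEGRAL MODEL USED BY THE TYPED INPUTS, `(E₀ mod ℓ)(𝔽_ℓ)`,
`E₀ = integralModelInt W`, `𝔽_ℓ = ZMod ℓ` (`X4.KuriharaUnitAt` asks `#(E₀ mod ℓ)(𝔽_ℓ)[p] ≤ p` at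
every level prime):

* `exists_addMonoidHom_reductionAt_intModel` — an INJECTIVE ADDITIVE map
  `Ẽ_v(k_v) →+ (E₀ mod ℓ)(ZMod ℓ)` (the tree's count identity
  `natCard_point_reduction_minimal_baseChange`, Silverman VII.1.3(b), upgraded to groups: the two
  minimal models differ by an integral change of variables, whose reduction acts on points by the
  group isomorphism `VariableChange.pointEquiv`; base change along `k_v ≅ ℤ_ℓ/ℓ ≅ ZMod ℓ`);
* `exists_addMonoidHom_torsion_reductionAt` — x11c's reduction embedding
  `E[p] →+ Ẽ_v(k_v)` under a Frobenius fixing `E[p]` (adapted verbatim from the proof of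
  `sq_dvd_reductionPointCount_of_forall_smul_eq`, which only exported the count);
* `sq_le_natCard_torsion_intModel_of_irr_of_not_surj` — **`irr(p) ∧ ¬surj(p)`, `ℓ ≠ p` good,
  `ℓ ≡ 1`, `a_ℓ ≡ 2 (mod p)` ⟹ `p² ≤ #(E₀ mod ℓ)(ZMod ℓ)[p]`**: `E[p] ⊂ Ẽ(𝔽_ℓ)`, the `p`-torsion of
  the reduction is NOT cyclic; Kim vocabulary `…_of_isKolyvaginPrime`;
* `X4.not_kuriharaUnitPrimeAt_of_irr_of_not_surj` — **the prime-level typed input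
  `X4.KuriharaUnitPrimeAt W p f` is FALSE on `irr ∧ ¬surj` pairs** (for every `f`), and
  `X4.kuriharaUnitAt_level_one_of_irr_of_not_surj` — **`X4.KuriharaUnitAt W p f` forces the level
  `n = 1`** there (the only Kurihara number left is `δ̃_1`).

Consequence for the cell (numbers, not adjectives): the rank-ONE Kurihara route (prime level,
`X4.bsdp_…_of_kuriharaUnitPrimeAt`, gen 0) is structurally EMPTY at every `irr ∧ ¬surj` pair —
X8's seven `3Nn` rank-1 pairs (7744bj1, 8800ba1, 8800d1, 15680cv1, 16562x1, 19600cx1, 19600da1 @3),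
X7's `18400r1 @3`, X10b's rank-1 pairs, X9 ∩ {r = 1}, and X4 ∩ {¬surj} — and the rank-zero route
reduces there to the `L`-value unit test `δ̃_1 ≠ 0`. Nothing booked; labels unchanged.

References: [Serre1972] §2.4 Prop. 15; [SilvermanAEC2009] VII.1.3(b), VII.2.1, VII.3.1(b),
III.6.4(b); [Kim2022StructureSelmer] §1.2.2; [Sakamoto2022pSelmer] Conj. 1.1.
-/

noncomputable section

open scoped Classical MatrixGroups ModularForm
open NumberField IsDedekindDomain IsDedekindDomain.HeightOneSpectrum Field WeierstrassCurve
  CongruenceSubgroup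
  Literature.NumberTheory.EllipticCurves Literature.NumberTheory.GaloisRepresentations
  Literature.NumberTheory.EllipticCurves.Rank1Residual

namespace Summit.BirchSwinnertonDyer.Rank1Residual.GaloisImage

universe u

/-! ## §1. Finiteness of the point group over a finite field -/

/-- The affine points of a Weierstrass curve over a finite field form a finite group (injection into
`Option (F × F)`; same proof as the tree's `BinaryQuartic.finite_point`). [folklore] -/
theorem finite_affinePoint {F : Type u} [Field F] [Finite F] (V : WeierstrassCurve F) :
    Finite V.toAffine.Point := by
  refine Finite.of_injective (fun P : V.toAffine.Point ↦ match P with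
    | .zero => (none : Option (F × F))
    | .some x y _ => some (x, y)) ?_
  intro P Q h
  rcases P with _ | ⟨x, y, hP⟩ <;> rcases Q with _ | ⟨x', y', hQ⟩
  · rfl
  · simp at h
  · simp at h
  · simp only [Option.some.injEq, Prod.mk.injEq] at h
    obtain ⟨rfl, rfl⟩ := h
    rfl

/-! ## §2. `Ẽ_v(k_v) →+ (E₀ mod ℓ)(ZMod ℓ)`, injective and additive -/

/-- **The reduction of the local minimal model and the reduction of the global minimal integral model
have isomorphic point groups, compatibly with `k_v ≅ ZMod ℓ`.** For a globally minimal `W/ℚ`, `v`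
the place above the prime `ℓ`: an injective additive map from the `k_v`-points of
`Ẽ_v = W.reductionAt v` (reduction of Mathlib's chosen minimal model `(W ⊗ ℚ_v).minimal 𝒪_v`) to the
`ZMod ℓ`-points of `E₀ mod ℓ`, `E₀ = integralModelInt W`. The two minimal equations differ by an
`𝒪_v`-integral change of variables `D` (`exists_variableChange_baseChange_eq_of_isMinimal`), the
reductions by `D mod v` (`reduction_smul_eq_of_baseChange_eq`), which acts on points by the group
isomorphism `VariableChange.pointEquiv`; the integral model of `W ⊗ ℚ_v` is `E₀ ⊗ 𝒪_v`
(`integralModel_adicCompletion_eq`); and base change along the field isomorphism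
`k_v ≅ ℤ_ℓ/ℓ ≅ ZMod ℓ` (`padicIntEquiv`, `PadicInt.residueField`) is an injective group homomorphism
(`Affine.Point.map_injective`). Silverman, AEC VII.1.3(b). [cite: SilvermanAEC2009, Prop. VII.1.3(b) (p. 186)] -/
theorem exists_addMonoidHom_reductionAt_intModel (W : WeierstrassCurve ℚ) [W.IsElliptic]
    [W.IsGloballyMinimal] {ℓ : ℕ} [hℓF : Fact ℓ.Prime] {v : HeightOneSpectrum (𝓞 ℚ)}
    (hvℓ : (Rat.HeightOneSpectrum.primesEquiv v : ℕ) = ℓ) :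
    ∃ j : ((W.reductionAt v).baseChange
        (IsLocalRing.ResidueField (v.adicCompletionIntegers ℚ))).toAffine.Point →+
        ((integralModelInt W).map (Int.castRingHom (ZMod ℓ))).toAffine.Point,
      Function.Injective j := by
  -- notation (`O = 𝓞_v`, `k = k_v`, `X = W ⊗ ℚ_v`)
  set k := IsLocalRing.ResidueField (v.adicCompletionIntegers ℚ) with hk
  haveI := Fact.mk (Rat.HeightOneSpectrum.primesEquiv v).2
  -- the two minimal models differ by an integral change of variables
  have hΔ : (W.baseChange (v.adicCompletion ℚ)).Δ ≠ 0 := by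
    rw [baseChange, map_Δ]
    exact (map_ne_zero _).mpr W.isUnit_Δ.ne_zero
  haveI hmin : IsMinimal (v.adicCompletionIntegers ℚ) (W.baseChange (v.adicCompletion ℚ)) :=
    IsGloballyMinimal.isMinimal v
  haveI hC : IsMinimal (v.adicCompletionIntegers ℚ)
      (((W.baseChange (v.adicCompletion ℚ)).exists_isMinimal (v.adicCompletionIntegers ℚ)).choose •
        W.baseChange (v.adicCompletion ℚ)) :=
    ((W.baseChange (v.adicCompletion ℚ)).exists_isMinimal (v.adicCompletionIntegers ℚ)).choose_spec
  obtain ⟨D, hD⟩ := exists_variableChange_baseChange_eq_of_isMinimal (R := v.adicCompletionIntegers ℚ)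
    (W.baseChange (v.adicCompletion ℚ))
    ((W.baseChange (v.adicCompletion ℚ)).exists_isMinimal (v.adicCompletionIntegers ℚ)).choose hΔ
  set W₁ : WeierstrassCurve k := (integralModelInt W).map
    ((IsLocalRing.residue (v.adicCompletionIntegers ℚ)).comp
      (Int.castRingHom (v.adicCompletionIntegers ℚ))) with hW₁
  have hXred : (W.baseChange (v.adicCompletion ℚ)).reduction (v.adicCompletionIntegers ℚ) = W₁ := by
    rw [hW₁, reduction, integralModel_adicCompletion_eq v W, map_map]
  have hWt : (W.reductionAt v).baseChange k =
      (D.map (IsLocalRing.residue (v.adicCompletionIntegers ℚ))) • W₁ := by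
    rw [baseChange, Algebra.algebraMap_self, map_id, ← hXred]
    change (((W.baseChange (v.adicCompletion ℚ)).exists_isMinimal (v.adicCompletionIntegers ℚ)).choose •
        W.baseChange (v.adicCompletion ℚ)).reduction (v.adicCompletionIntegers ℚ) = _
    exact reduction_smul_eq_of_baseChange_eq _ _ D hD
  -- the residue field is `ZMod ℓ`
  let ψ : k ≃+* ZMod ℓ :=
    ((IsLocalRing.ResidueField.mapEquiv
      (Rat.HeightOneSpectrum.adicCompletionIntegers.padicIntEquiv v).toAlgEquiv.toRingEquiv).trans
      (PadicInt.residueField (p := (Rat.HeightOneSpectrum.primesEquiv v : ℕ)))).trans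
      (ZMod.ringEquivCongr hvℓ)
  letI : Algebra k (ZMod ℓ) := ψ.toRingHom.toAlgebra
  have hW₁k : W₁.baseChange k = W₁ := by
    rw [baseChange, Algebra.algebraMap_self, map_id]
  have hW₁Z : W₁.baseChange (ZMod ℓ) = (integralModelInt W).map (Int.castRingHom (ZMod ℓ)) := by
    rw [baseChange, RingHom.algebraMap_toAlgebra, hW₁, map_map]
    exact congrArg (integralModelInt W).map (RingHom.ext_int _ _)
  -- the maps
  let e₁ : ((W.reductionAt v).baseChange k).toAffine.Point ≃+
      ((D.map (IsLocalRing.residue (v.adicCompletionIntegers ℚ))) • W₁).toAffine.Point :=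
    Affine.Point.congrEquiv hWt
  let e₂ : ((D.map (IsLocalRing.residue (v.adicCompletionIntegers ℚ))) • W₁).toAffine.Point ≃+
      W₁.toAffine.Point :=
    (VariableChange.pointEquiv W₁ (D.map (IsLocalRing.residue (v.adicCompletionIntegers ℚ)))).symm
  let e₃ : W₁.toAffine.Point ≃+ (W₁.baseChange k).toAffine.Point := Affine.Point.congrEquiv hW₁k.symm
  let bc : (W₁.baseChange k).toAffine.Point →+ (W₁.baseChange (ZMod ℓ)).toAffine.Point :=
    Affine.Point.baseChange k (ZMod ℓ)
  have hbc : Function.Injective bc := Affine.Point.map_injective _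
  let e₄ : (W₁.baseChange (ZMod ℓ)).toAffine.Point ≃+
      ((integralModelInt W).map (Int.castRingHom (ZMod ℓ))).toAffine.Point := Affine.Point.congrEquiv hW₁Z
  refine ⟨e₄.toAddMonoidHom.comp (bc.comp (e₃.toAddMonoidHom.comp
    (e₂.toAddMonoidHom.comp e₁.toAddMonoidHom))), ?_⟩
  exact e₄.injective.comp (hbc.comp (e₃.injective.comp (e₂.injective.comp e₁.injective)))

/-! ## §3. `E[p] →+ Ẽ_v(k_v)` under a Frobenius fixing `E[p]` (x11c's embedding, exported) -/

/-- **The reduction embedding `E[p] ↪ Ẽ_v(k_v)` as an additive map** (adapted from the proof of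
x11c's `sq_dvd_reductionPointCount_of_forall_smul_eq`, which exported only the count): for a
globally minimal `E = W/ℚ`, primes `ℓ ≠ p`, `W` good at `ℓ`, `v ∋ ℓ`, `𝔓 ∣ v`, `φ` an arithmetic
Frobenius at `𝔓` fixing every point of `E[p]`, there is an INJECTIVE additive map
`E[p] →+ Ẽ_v(k_v)`: the reduction map on `p`-primary torsion along an embedding `ℚ̄ → ℚ̄_v`
(`exists_reduceTorsionHom`, Silverman VII.2.1 / VII.3.1(b)) intertwines a local Frobenius with
`x ↦ x^ℓ`, so it sends the `φ`-fixed `E[p]` to `x ↦ x^ℓ`-fixed, i.e. `k_v`-rational, points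
(`exists_baseChange_eq_of_frobenius_smul_eq`); the passage from `(𝔓, φ)` to the embedding's
Frobenius is by conjugation and the triviality of inertia on `E[p]` (VII.4.1(a)).
[cite: SilvermanAEC2009, Prop. VII.3.1(b) (PDF p. 170), Prop. VII.2.1, proof of Prop. VII.4.1(a)] -/
theorem exists_addMonoidHom_torsion_reductionAt (W : WeierstrassCurve ℚ) [W.IsElliptic]
    [W.IsGloballyMinimal] (p ℓ : ℕ) [Fact p.Prime] [Fact ℓ.Prime] (hℓp : ℓ ≠ p)
    (hgoodℓ : W.HasGoodReductionAtPrime ℓ) {v : HeightOneSpectrum (𝓞 ℚ)}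
    (hv : (ℓ : 𝓞 ℚ) ∈ v.asIdeal) {𝔓 : Ideal (absIntegers (𝓞 ℚ) ℚ)} (h𝔓 : 𝔓 ∈ v.primesAbove)
    {φ : absoluteGaloisGroup ℚ} (hφ : IsArithFrobAt (𝓞 ℚ) φ 𝔓)
    (hfix : ∀ P : W.geomTorsion p, φ • P = P) :
    ∃ h : W.geomTorsion p →+ ((W.reductionAt v).baseChange
        (IsLocalRing.ResidueField (v.adicCompletionIntegers ℚ))).toAffine.Point,
      Function.Injective h := by
  -- adapted from Summits/BirchSwinnertonDyer/Rank1Residual/GaloisImage/FrobeniusOrderWitness.lean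
  -- (x11c, `sq_dvd_reductionPointCount_of_forall_smul_eq`)
  have hp : p.Prime := Fact.out
  have hℓ : ℓ.Prime := Fact.out
  have hvℓ : (Rat.HeightOneSpectrum.primesEquiv v : ℕ) = ℓ := primesEquiv_eq_of_natCast_mem hℓ hv
  have hgood : W.HasGoodReductionAt v :=
    (hasGoodReductionAtPrime_primesEquiv_iff_holds W v ℓ hvℓ).mp hgoodℓ
  have hpv : (p : 𝓞 ℚ) ∉ v.asIdeal := fun h ↦
    hℓp (hvℓ.symm.trans (primesEquiv_eq_of_natCast_mem hp h))
  set k := IsLocalRing.ResidueField (v.adicCompletionIntegers ℚ) with hk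
  set Wt : WeierstrassCurve k := W.reductionAt v with hWt
  haveI : Wt.IsElliptic := isElliptic_reductionAt hgood
  -- the reduction map on `p`-primary torsion along `ι`, for a local Frobenius `σ_v`
  obtain ⟨𝔐, h𝔐⟩ := v.localPrimesAbove_nonempty
  let ι : AlgebraicClosure ℚ →ₐ[ℚ] AlgebraicClosure (v.adicCompletion ℚ) :=
    closureEmb (K := ℚ) (v.adicCompletion ℚ)
  obtain ⟨σL, hσL⟩ := v.exists_isArithFrobAt_localAbsIntegers h𝔐
  obtain ⟨φk, hφk⟩ := exists_frobenius_absoluteGaloisGroup k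
  obtain ⟨f, hf, hfσ⟩ := exists_reduceTorsionHom hpv hgood h𝔐 ι hσL hφk
  set σ₀ : absoluteGaloisGroup ℚ := resGalOfEmb ι σL with hσ₀
  -- transport: `σ₀` also acts trivially on `E[p]`
  have h𝔓₀ : v.primeBelow ι 𝔐 ∈ v.primesAbove := primeBelow_mem_primesAbove h𝔐
  have hσ₀F : IsArithFrobAt (𝓞 ℚ) σ₀ (v.primeBelow ι 𝔐) := isArithFrobAt_resGalOfEmb h𝔐 ι hσL
  obtain ⟨τ, hτ⟩ := exists_smul_eq_of_mem_primesAbove_holds h𝔓₀ h𝔓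
  have hγ : IsArithFrobAt (𝓞 ℚ) (τ * σ₀ * τ⁻¹) 𝔓 := hτ ▸ hσ₀F.conj τ
  have hI : φ * (τ * σ₀ * τ⁻¹)⁻¹ ∈ 𝔓.inertia (absoluteGaloisGroup ℚ) := hφ.mul_inv_mem_inertia hγ
  have hfixpt : ∀ X : geomPoints W, p • X = 0 → φ • X = X := fun X hX ↦ by
    have := congrArg Subtype.val (hfix ⟨X, AddSubgroup.torsionBy.nsmul_iff.mpr hX⟩)
    rwa [AddSubgroup.torsionBy.coe_smul] at this
  have hγfix : ∀ X : geomPoints W, p • X = 0 → (τ * σ₀ * τ⁻¹) • X = X := fun X hX ↦ by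
    have h1 : (τ * σ₀ * τ⁻¹) • X = (φ * (τ * σ₀ * τ⁻¹)⁻¹)⁻¹ • (φ • X) := by
      rw [← mul_smul, mul_inv_rev, inv_inv, inv_mul_cancel_right]
    rw [h1, hfixpt X hX]
    exact W.smul_eq_of_mem_inertia_of_nsmul_eq_zero hgood hpv h𝔓 (inv_mem hI) hX
  have hσ₀fix : ∀ X : geomPoints W, p • X = 0 → σ₀ • X = X := fun X hX ↦ by
    have hτX : p • (τ • X) = 0 := by rw [smul_comm, hX, smul_zero]
    have h1 := hγfix (τ • X) hτX
    rw [mul_smul, mul_smul, inv_smul_smul] at h1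
    exact smul_left_cancel τ h1
  -- the injective homomorphism `E[p] → Ẽ_v(k_v)`
  let incl : W.geomTorsion p →+ W.geomPrimaryTorsion p :=
    { toFun := fun P ↦ ⟨P, 1, by
        have := AddSubgroup.torsionBy.nsmul_iff.mp P.2
        simpa only [pow_one] using this⟩
      map_zero' := rfl
      map_add' := fun _ _ ↦ rfl }
  have hincl : Function.Injective incl := fun P Q h ↦ by
    apply Subtype.ext
    have := congrArg Subtype.val h
    exact this
  let g : W.geomTorsion p →+ geomPoints Wt := f.comp incl
  have hg : Function.Injective g := hf.comp hincl
  have hgfix : ∀ P : W.geomTorsion p, φk • g P = g P := fun P ↦ by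
    have hP : p • (P : geomPoints W) = 0 := AddSubgroup.torsionBy.nsmul_iff.mp P.2
    have h1 : σ₀ • incl P = incl P := by
      apply Subtype.ext
      rw [primaryComponent.coe_smul]
      exact hσ₀fix P hP
    show φk • f (incl P) = f (incl P)
    rw [← hfσ, h1]
  let bc : (Wt.baseChange k).toAffine.Point →+ geomPoints Wt :=
    Affine.Point.baseChange k (AlgebraicClosure k)
  have hbc : Function.Injective bc := Affine.Point.map_injective _
  have hrange : ∀ P : W.geomTorsion p, g P ∈ bc.range := fun P ↦ by
    obtain ⟨R₀, hR₀⟩ := exists_baseChange_eq_of_frobenius_smul_eq Wt hφk (hgfix P)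
    exact ⟨R₀, hR₀⟩
  let g' : W.geomTorsion p →+ bc.range := g.codRestrict bc.range hrange
  let e : (Wt.baseChange k).toAffine.Point ≃+ bc.range := AddMonoidHom.ofInjective hbc
  let h : W.geomTorsion p →+ (Wt.baseChange k).toAffine.Point :=
    e.symm.toAddMonoidHom.comp g'
  have hh : Function.Injective h := by
    refine e.symm.injective.comp ?_
    intro P Q hPQ
    exact hg (congrArg Subtype.val hPQ)
  exact ⟨h, hh⟩

/-! ## §4. `p² ≤ #(E₀ mod ℓ)(ZMod ℓ)[p]` -/

/-- **`E[p] ⊂ Ẽ(𝔽_ℓ)` on the integral model: if a Frobenius at the good prime `ℓ ≠ p` fixes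
`E[p]`, then the `p`-torsion of `(E₀ mod ℓ)(ZMod ℓ)` has at least `p²` elements** (the `p²` points of
`E[p]`, AEC III.6.4(b), embed additively: §3 then §2). [cite: SilvermanAEC2009, Prop. VII.3.1(b) and Cor. III.6.4(b)] -/
theorem sq_le_natCard_torsion_intModel_of_forall_smul_eq (W : WeierstrassCurve ℚ) [W.IsElliptic]
    [W.IsGloballyMinimal] (p ℓ : ℕ) [Fact p.Prime] [Fact ℓ.Prime] (hℓp : ℓ ≠ p)
    (hgoodℓ : W.HasGoodReductionAtPrime ℓ) {v : HeightOneSpectrum (𝓞 ℚ)}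
    (hv : (ℓ : 𝓞 ℚ) ∈ v.asIdeal) {𝔓 : Ideal (absIntegers (𝓞 ℚ) ℚ)} (h𝔓 : 𝔓 ∈ v.primesAbove)
    {φ : absoluteGaloisGroup ℚ} (hφ : IsArithFrobAt (𝓞 ℚ) φ 𝔓)
    (hfix : ∀ P : W.geomTorsion p, φ • P = P) :
    p ^ 2 ≤ Nat.card {P : ((integralModelInt W).map (Int.castRingHom (ZMod ℓ))).toAffine.Point //
      p • P = 0} := by
  have hp : p.Prime := Fact.out
  have hℓ : ℓ.Prime := Fact.out
  have hvℓ : (Rat.HeightOneSpectrum.primesEquiv v : ℕ) = ℓ := primesEquiv_eq_of_natCast_mem hℓ hv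
  obtain ⟨h, hh⟩ := exists_addMonoidHom_torsion_reductionAt W p ℓ hℓp hgoodℓ hv h𝔓 hφ hfix
  obtain ⟨j, hj⟩ := exists_addMonoidHom_reductionAt_intModel W (ℓ := ℓ) hvℓ
  set T := ((integralModelInt W).map (Int.castRingHom (ZMod ℓ))).toAffine.Point
  haveI : Finite T := finite_affinePoint _
  let H : W.geomTorsion p →+ T := j.comp h
  have hH : Function.Injective H := hj.comp hh
  have hHp : ∀ P : W.geomTorsion p, p • H P = 0 := fun P ↦ by
    have hP : p • P = 0 := by
      apply Subtype.ext
      rw [AddSubgroupClass.coe_nsmul, ZeroMemClass.coe_zero]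
      exact AddSubgroup.torsionBy.nsmul_iff.mp P.2
    rw [← map_nsmul, hP, map_zero]
  let H' : W.geomTorsion p → {P : T // p • P = 0} := fun P ↦ ⟨H P, hHp P⟩
  have hH' : Function.Injective H' := fun P Q hPQ ↦ hH (congrArg Subtype.val hPQ)
  have hA : Nat.card (W.geomTorsion (p : ℕ)) = p ^ 2 :=
    card_torsionPoints_eq_sq_holds W (AlgebraicClosure ℚ) (n := p) (Nat.cast_ne_zero.mpr hp.ne_zero)
  rw [← hA]
  exact Nat.card_le_card_of_injective H' hH'

/-- **Irreducible, non-surjective image ⟹ `Ẽ(𝔽_ℓ)[p]` is NOT cyclic at any Kolyvagin prime: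
`p² ≤ #(E₀ mod ℓ)(ZMod ℓ)[p]`** for every good `ℓ ≠ p` with `ℓ ≡ 1`, `a_ℓ ≡ 2 (mod p)` (the Frobenius
at `ℓ` fixes `E[p]`, `galoisRepTorsion_frobenius_eq_one_of_irr_of_not_surj`, p216591).
[cite: Serre1972, §2.4 Prop. 15] [cite: SilvermanAEC2009, Prop. VII.3.1(b)] -/
theorem sq_le_natCard_torsion_intModel_of_irr_of_not_surj (W : WeierstrassCurve ℚ) [W.IsElliptic]
    [W.IsGloballyMinimal] (p ℓ : ℕ) [Fact p.Prime] [hℓF : Fact ℓ.Prime] (hℓp : ℓ ≠ p)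
    (hgood : W.HasGoodReductionAtPrime ℓ) (hirr : W.HasIrreducibleModPGaloisRep p)
    (hns : ¬ W.HasSurjectiveModNGaloisRep p) (hℓ1 : (ℓ : ZMod p) = 1)
    (htr : (W.frobeniusTrace ℓ : ZMod p) = 2) :
    p ^ 2 ≤ Nat.card {P : ((integralModelInt W).map (Int.castRingHom (ZMod ℓ))).toAffine.Point //
      p • P = 0} := by
  set v : HeightOneSpectrum (𝓞 ℚ) := (Rat.HeightOneSpectrum.primesEquiv (R := 𝓞 ℚ)).symm
    ⟨ℓ, hℓF.out⟩ with hvdef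
  have hvℓ : (Rat.HeightOneSpectrum.primesEquiv v : ℕ) = ℓ := by
    rw [hvdef, Equiv.apply_symm_apply]
  have hv : (ℓ : 𝓞 ℚ) ∈ v.asIdeal := by
    rw [DeuringLadic.natCast_mem_asIdeal_iff v ℓ, hvℓ]
  obtain ⟨𝔓, h𝔓⟩ := v.primesAbove_nonempty
  obtain ⟨φ, hφ⟩ := HeightOneSpectrum.exists_isArithFrobAt_of_mem_primesAbove_holds (v := v) h𝔓
  have hρ := galoisRepTorsion_frobenius_eq_one_of_irr_of_not_surj W p ℓ hℓp hgood hirr hns hℓ1 htr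
    hvℓ h𝔓 hφ
  refine sq_le_natCard_torsion_intModel_of_forall_smul_eq W p ℓ hℓp hgood hv h𝔓 hφ fun P ↦ ?_
  have h1 : (galoisRepTorsion W p φ).toAdd P = P := by rw [hρ]; rfl
  exact h1

/-- **The same in Kim's vocabulary**: `irr(p) ∧ ¬surj(p)` and `ℓ ∈ 𝒫₁(E,p)`
(`Kato.IsKolyvaginPrime W p 1 ℓ`) ⟹ `p² ≤ #(E₀ mod ℓ)(ZMod ℓ)[p]`; in particular `ℓ ∉ 𝒫_{1,0}`
(Sakamoto's cyclic levels). [cite: Kim2022StructureSelmer, §1.2.2] [cite: Sakamoto2022pSelmer, Conj. 1.1] -/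
theorem sq_le_natCard_torsion_intModel_of_isKolyvaginPrime (W : WeierstrassCurve ℚ) [W.IsElliptic]
    [W.IsGloballyMinimal] (p : ℕ) [hp : Fact p.Prime] (hirr : Irr W p) (hns : ¬ Surj W p) {ℓ : ℕ}
    [Fact ℓ.Prime] (hK : Kato.IsKolyvaginPrime W p 1 ℓ) :
    p ^ 2 ≤ Nat.card {P : ((integralModelInt W).map (Int.castRingHom (ZMod ℓ))).toAffine.Point //
      p • P = 0} := by
  have hgood : W.HasGoodReductionAtPrime ℓ :=
    hasGoodReductionAtPrime_of_not_dvd_conductorNorm W hK.not_dvd_conductorNorm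
  have hℓ1 : (ℓ : ZMod p) = 1 := by
    have h := hK.modEq_one
    rw [pow_one] at h
    have h' := (ZMod.natCast_eq_natCast_iff ℓ 1 p).mpr h
    rwa [Nat.cast_one] at h'
  have htr : (W.frobeniusTrace ℓ : ZMod p) = 2 := by
    have h := hK.frobeniusTrace_modEq
    rw [pow_one] at h
    have h' := (ZMod.intCast_eq_intCast_iff _ _ _).mpr h
    rw [Int.cast_add, Int.cast_natCast, Int.cast_one, hℓ1] at h'
    rw [h']
    norm_num
  exact sq_le_natCard_torsion_intModel_of_irr_of_not_surj W p ℓ hK.ne hgood hirr hns hℓ1 htr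

end Summit.BirchSwinnertonDyer.Rank1Residual.GaloisImage

/-! ## §5. The typed Kurihara inputs of `X4/KuriharaClasswide.lean` at `irr ∧ ¬surj` -/

namespace Summit.BirchSwinnertonDyer.Rank1Residual.X4

open Summit.BirchSwinnertonDyer.Rank1Residual.GaloisImage

/-- **`X4.KuriharaUnitPrimeAt W p f` is FALSE at a prime of irreducible, non-surjective image**
(for every newform `f` and every level): its witness would be a Kolyvagin prime `ℓ` with
`#(E₀ mod ℓ)(ZMod ℓ)[p] ≤ p`, while `p² ≤ #(E₀ mod ℓ)(ZMod ℓ)[p]`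
(`sq_le_natCard_torsion_intModel_of_isKolyvaginPrime`) and `p < p²`. So the rank-ONE Kurihara route
of this unit's gen-0 files (`X4.bsdp_…_of_kuriharaUnitPrimeAt`) is structurally empty on
`irr ∧ ¬surj` pairs. A no-go on a typed input; nothing booked. [cite: Serre1972, §2.4 Prop. 15]
[cite: Kim2022StructureSelmer, §1.2.2 and Thm. 1.8] -/
theorem not_kuriharaUnitPrimeAt_of_irr_of_not_surj (W : WeierstrassCurve ℚ) [W.IsElliptic]
    [W.IsGloballyMinimal] (p : ℕ) [hp : Fact p.Prime] (hirr : Irr W p) (hns : ¬ Surj W p)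
    {N : ℕ} [NeZero N] (f : CuspForm (Gamma0 N) 2) : ¬ KuriharaUnitPrimeAt W p f := by
  rintro ⟨ℓ, hℓF, hK, hcyc, -⟩
  haveI := hℓF
  have h2 := sq_le_natCard_torsion_intModel_of_isKolyvaginPrime W p hirr hns hK
  have hp2 : 2 ≤ p := hp.out.two_le
  have : p < p ^ 2 := by nlinarith
  omega

/-- **`X4.KuriharaUnitAt W p f` forces the level `n = 1` at a prime of irreducible, non-surjective
image**: every prime factor of the witnessing level `n ∈ 𝒩₁` would be a Kolyvagin prime with cyclic
`Ẽ(𝔽_ℓ)[p]`, impossible; so `n` has no prime factor, `n = 1`, and what is witnessed is only a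
non-zero Kurihara number of level `1` (`δ̃_1`, the `L`-value term). [cite: Serre1972, §2.4 Prop. 15]
[cite: Kim2022StructureSelmer, §1.2.2 and Thm. 1.10] -/
theorem kuriharaUnitAt_level_one_of_irr_of_not_surj (W : WeierstrassCurve ℚ) [W.IsElliptic]
    [W.IsGloballyMinimal] (p : ℕ) [hp : Fact p.Prime] (hirr : Irr W p) (hns : ¬ Surj W p)
    {N : ℕ} [NeZero N] (f : CuspForm (Gamma0 N) 2) (h : KuriharaUnitAt W p f) :
    ∃ ψ : (ℓ : ℕ) → (ZMod ℓ)ˣ →* Multiplicative (ZMod (p ^ 1)), kuriharaNumber f (p ^ 1) 1 ψ ≠ 0 := by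
  obtain ⟨n, hn, hprod, hcyc, ψ, -, hδ⟩ := h
  have hp2 : 2 ≤ p := hp.out.two_le
  have hpp : p < p ^ 2 := by nlinarith
  -- `n` has no prime factor
  have hempty : n.primeFactors = ∅ := by
    by_contra hne
    obtain ⟨ℓ, hℓ⟩ := Finset.nonempty_iff_ne_empty.mpr hne
    have hK : Kato.IsKolyvaginPrime W p 1 ℓ := hprod.2 ℓ hℓ
    haveI : Fact ℓ.Prime := ⟨hK.prime⟩
    have h2 := sq_le_natCard_torsion_intModel_of_isKolyvaginPrime W p hirr hns hK
    have h3 := hcyc ℓ (Nat.dvd_of_mem_primeFactors hℓ)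
    omega
  have hn1 : n = 1 := by
    rcases Nat.primeFactors_eq_empty.mp hempty with h0 | h1
    · exact absurd h0 hn.out
    · exact h1
  subst hn1
  exact ⟨ψ, hδ⟩

end Summit.BirchSwinnertonDyer.Rank1Residual.X4

end
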